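import Literature.NumberTheory.EllipticCurves.ZpExtensionEisensteinDVRSetting
import Literature.NumberTheory.EllipticCurves.ZpExtensionEisensteinSelmerH5bUnramifiedProofs
import HarnessLib

/-!
# Reduction of `SatisfiesH.h5b` for the curve's Eisenstein setting (canonical conjugation datum) to the finite places of
# `S` (proofs file)

Topic `NumberTheory/EllipticCurves` (D1 road of cell `pub/bsd-print-x9`; companion of `ZpExtensionEisensteinDVRSetting`;
consumer of x9-p1-w3's `ZpExtensionEisensteinSelmerH5bUnramifiedProofs`, p650682).  THEOREMS ONLY; no definition, no named
fact, no instance, no notation, no `sorry`.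

Howard, H.5(b) [arXiv:1202.6340 p. 7, L83–85]: «`τ` takes the local condition `F` at `w` (propagated to `T̄`) isomorphically
to the local condition at `w^τ`».  For the Eisenstein setting of `E_K` with the CANONICAL conjugation datum
`ConjugationDatum.ofLifts σ … τ …` (an involution `σ` of `K`, an involutive lift `τ` to `K̄`), x9-p1-w3 proved the clause
at every finite place OFF `S` together with its conjugate (`F_𝔮` unramified there; `φ_v` respects inertia).  Hence:
* **`WeierstrassCurve.eisensteinDVRSetting_h5b_of`** — if `S` is `σ`-stable, `SatisfiesH.h5b` at level `k` follows from
  its clauses at the places `v ∈ S` (the genuinely local-arithmetic ones: `v ∣ p` ordinary — `τ` carries `Fil_v̄` to `Fil_v`,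
  the cell's (f)/(E2) seats — and `v ∈ S ∖ {p}` saturated-unramified).
The statement carries the CONSUMER PREAMBLE of `ZpExtensionEisensteinDVRSetting`.  BSD is not proved by any of this.

References: [Howard2004HeegnerKolyvagin] H.5(b) (arXiv p. 7, L83–85), Def. 3.1.2, Prop. 3.1.3; [MilneADT2006] I §2.
-/

set_option autoImplicit false

noncomputable section

open Function NumberField IsDedekindDomain Field
open scoped NumberField ContRepresentation TensorProduct Classical

namespace WeierstrassCurve

open Literature.NumberTheory.EllipticCurves Literature.NumberTheory.GaloisRepresentations
open Literature.NumberTheory.GaloisRepresentations.DiscreteGaloisModule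
open Literature.NumberTheory.GaloisCohomology.Howard2004
open Literature.NumberTheory.EllipticCurves.ZpExtension (EisensteinLevel)

variable {K : Type} [Field K] [NumberField K] (W : WeierstrassCurve ℚ) [W.IsElliptic] {p : ℕ} [hp : Fact p.Prime]
  (κ : ZpExtension K p) {m : ℕ} (hm : 1 ≤ m)
  (S : Finset (HeightOneSpectrum (𝓞 K)))
  (hpS : ∀ v : HeightOneSpectrum (𝓞 K), ((p : ℕ) : 𝓞 K) ∈ v.asIdeal → v ∈ S)
  (hbad : ∀ v : HeightOneSpectrum (𝓞 K), v ∉ S → ((p : ℕ) : 𝓞 K) ∉ v.asIdeal → (W.baseChange K).HasGoodReductionAt v)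
  (L : Set (HeightOneSpectrum (𝓞 K)))
  (hL : letI := IwasawaAlgebra.isLocalRing_quotient_X_pow_add_C p hm
    L ⊆ (W.eisensteinTower κ hm).degreeTwoPrimes p)
  (hLS : ∀ v ∈ L, v ∉ S)
  (jbar : AlgebraicClosure K →+* ℂ)
  (σ : K ≃ₐ[ℚ] K) (hσ₁ : σ ≠ 1) (hσ : σ * σ = 1) (τ : AlgebraicClosure K ≃+* AlgebraicClosure K)
  (hτ : IsLiftOfAut σ τ) (hτ₂ : Function.Involutive τ)
  (D : letI := IwasawaAlgebra.isLocalRing_quotient_X_pow_add_C p hm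
    ∀ k, DualityDatum p (ConjugationDatum.ofLifts σ hσ₁ hσ τ hτ hτ₂) ((W.eisensteinTower κ hm).ρ k) (IwasawaAlgebra.EisensteinCoeff p m (k + 1)))
  (fs : letI := IwasawaAlgebra.isLocalRing_quotient_X_pow_add_C p hm
    ∀ (k : ℕ) (n : Finset (HeightOneSpectrum (𝓞 K))) (v : HeightOneSpectrum (𝓞 K)),
      galoisCohomology ((W.eisensteinLevelQuot κ hm k n).toLocal (Sum.inr v)) 1 →+
        SingularQuotient (GaloisRep.toLocal v (W.eisensteinLevelQuot κ hm k n)) ⊗[ℤ] Gell v)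

set_option synthInstance.maxHeartbeats 80000 in
/-- **`SatisfiesH.h5b` for the curve's Eisenstein setting with the canonical conjugation datum reduces to the places of
`S`**: for `σ`-stable `S` (containing the places above `p` and the bad places), H.5(b) at level `k` — «`τ` carries the
propagated condition `F_𝔮` at `σ•v` onto the one at `v`» for EVERY finite `v` — follows from the clauses at `v ∈ S`; off
`S` it is x9-p1-w3's `eisensteinSelmerStructure_h5b_inr_of_not_mem_ofLifts` (`F_𝔮` unramified at `v` and `σ•v`).
[cite: Howard2004HeegnerKolyvagin, H.5(b) (arXiv p. 7, L83–85) and Def. 3.1.2] -/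
theorem eisensteinDVRSetting_h5b_of (hSσ : ∀ v : HeightOneSpectrum (𝓞 K), σ • v ∈ S → v ∈ S)
    (hfin :
    letI := IwasawaAlgebra.isDomain_quotient_X_pow_add_C p hm
    letI := IwasawaAlgebra.isDiscreteValuationRing_quotient_X_pow_add_C p hm
    haveI := IwasawaAlgebra.EisensteinCoeff.isLocalRing_succ p hm
    letI := IwasawaAlgebra.EisensteinCoeff.algebraOfSpecSucc p m
    haveI := W.isScalarTower_algebraOfSpecSucc (K := K) (p := p) (m := m)
    letI := W.residueModuleSucc (K := K) (p := p) hm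
      ∀ k, ∀ v ∈ S,
        (((W.isQuotientBy_eisensteinDVRSetting_πbar κ hm S hpS hbad L hL hLS jbar (ConjugationDatum.ofLifts σ hσ₁ hσ τ hτ hτ₂) D fs k).propagateStructure (W.eisensteinTowerTriple κ hm S hpS hbad L hL hLS k).cond) (Sum.inr (σ • v))).map
            (((W.residualTauGeomTorsion (p := p) (ConjugationDatum.ofLifts σ hσ₁ hσ τ hτ hτ₂) hm (k := k + 1) k.succ_pos).thetaH1 (Sum.inr v)).comp
              ((ConjugationDatum.ofLifts σ hσ₁ hσ τ hτ hτ₂).transportH1 ((W.baseChange K).torsionGaloisModule (p : ℤ)) v)) =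
          ((W.isQuotientBy_eisensteinDVRSetting_πbar κ hm S hpS hbad L hL hLS jbar (ConjugationDatum.ofLifts σ hσ₁ hσ τ hτ hτ₂) D fs k).propagateStructure (W.eisensteinTowerTriple κ hm S hpS hbad L hL hLS k).cond) (Sum.inr v))
    (k : ℕ) :
    letI := IwasawaAlgebra.isDomain_quotient_X_pow_add_C p hm
    letI := IwasawaAlgebra.isDiscreteValuationRing_quotient_X_pow_add_C p hm
    haveI := IwasawaAlgebra.EisensteinCoeff.isLocalRing_succ p hm
    letI := IwasawaAlgebra.EisensteinCoeff.algebraOfSpecSucc p m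
    haveI := W.isScalarTower_algebraOfSpecSucc (K := K) (p := p) (m := m)
    letI := W.residueModuleSucc (K := K) (p := p) hm
    H5b (R := IwasawaAlgebra.EisensteinCoeff p m (k + 1)) ((W.eisensteinTower κ hm).ρ k) (W.isQuotientBy_eisensteinDVRSetting_πbar κ hm S hpS hbad L hL hLS jbar (ConjugationDatum.ofLifts σ hσ₁ hσ τ hτ hτ₂) D fs k) (W.residualTauGeomTorsion (p := p) (ConjugationDatum.ofLifts σ hσ₁ hσ τ hτ hτ₂) hm (k := k + 1) k.succ_pos) (W.eisensteinTowerTriple κ hm S hpS hbad L hL hLS k).cond := by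
  letI := IwasawaAlgebra.isDomain_quotient_X_pow_add_C p hm
  letI := IwasawaAlgebra.isDiscreteValuationRing_quotient_X_pow_add_C p hm
  haveI := IwasawaAlgebra.EisensteinCoeff.isLocalRing_succ p hm
  letI := IwasawaAlgebra.EisensteinCoeff.algebraOfSpecSucc p m
  haveI := W.isScalarTower_algebraOfSpecSucc (K := K) (p := p) (m := m)
  letI := W.residueModuleSucc (K := K) (p := p) hm
  intro v
  by_cases hvS : v ∈ S
  · exact hfin k v hvS
  · have hσvS : σ • v ∉ S := fun h ↦ hvS (hSσ v h)
    have hv : ((p : ℕ) : 𝓞 K) ∉ v.asIdeal := fun h ↦ hvS (hpS v h)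
    have hσv : ((p : ℕ) : 𝓞 K) ∉ (σ • v).asIdeal := fun h ↦ hσvS (hpS _ h)
    exact (W.baseChange K).eisensteinSelmerStructure_h5b_inr_of_not_mem_ofLifts κ hm
      (fun j ↦ (W.baseChange K).torsionGaloisModuleReduce p j) S
      (fun v _ ↦ (W.baseChange K).ordinaryFiltrationAt v (fun j ↦ (W.baseChange K).torsionGaloisModuleReduce p j)
        (fun _ _ ↦ rfl))
      hbad (k + 1) σ hσ₁ hσ τ hτ hτ₂ (W.isQuotientBy_eisensteinDVRSetting_πbar κ hm S hpS hbad L hL hLS jbar (ConjugationDatum.ofLifts σ hσ₁ hσ τ hτ hτ₂) D fs k) (W.residualTauGeomTorsion (p := p) (ConjugationDatum.ofLifts σ hσ₁ hσ τ hτ hτ₂) hm (k := k + 1) k.succ_pos) hv hvS hσv hσvS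

end WeierstrassCurve

end
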